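import Literature.AlgebraicGeometry.HodgeTheory.GAGAPicardInjective
import Literature.AlgebraicGeometry.HodgeTheory.GAGARegularOfHolomorphicNumerator
import Literature.AlgebraicGeometry.HodgeTheory.CartierDivisorChernClass
import Literature.AlgebraicGeometry.FundamentalGroup.RiemannExistenceCharPolyRegular
import Literature.AlgebraicGeometry.Motives.AbelianVarietyProjectiveChart
import Literature.Geometry.Kaehler.HolomorphicLineBundleSectionsFinite
import HarnessLib

/-!
# GAGA for `H⁰` of a line bundle: `Γ(X, 𝒪_X(D)) ≅ Γ(X^an, 𝒪_X(D)^an)` for a smooth projective `X/ℂ`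

J.-P. Serre, *Géométrie algébrique et géométrie analytique*, Ann. Inst. Fourier 6 (1956), n° 12 Théorème 1
(`H⁰(X, ℱ) → H⁰(X^h, ℱ^h)` is bijective for `ℱ` coherent on `X` projective), here for the invertible sheaf
`ℱ = 𝒪_X(D)` of a Cartier divisor `D = (U_i, f_i)` on a SMOOTH projective `X/ℂ`, on the tree's carriers: an
analytification `φ : M → X(ℂ)` (`IsAnalytification`, holomorphic atlas), the `ℂ`-vector space
`Γ(X, 𝒪_X(D)) = D.sections ℂ ⊆ K(X)` (`Motives/CartierDivisor`, Görtz–Wedhorn I (11.9)) and the space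
`(cartierDivisorLineBundle hφ D).sectionSpace` of global holomorphic sections of the cocycle line bundle
`𝒪_X(D)^an` (`HodgeTheory/CartierDivisorChernClass`, `Geometry/Kaehler/HolomorphicLineBundleSectionsFinite`).
THEOREMS ONLY (no definition, no instance, no named fact).  Cell hodgecm-mathlib, F-2 (b) rank brick (R1) of
`B-provers/B-p05/g17/CENSUS-F2b-Rank.B-p05g17.md` (GAGA-`H⁰`; consumer (R2) `h⁰(A, 𝒪(Θ))² = #K(Θ)(ℂ)`).
HC_CM is proved only modulo the 7 printed citations until rung 0 closes.

## What is proved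

* `sectionCoord_mem_sectionSpace` — the analytification `s ↦ s^an = ((f_i s) ∘ φ)_i` (coordinates
  `CartierDivisor.sectionCoord`, zero off `φ⁻¹(U_i(ℂ))`) lands in the section space; it is additive and
  `ℂ`-homogeneous (`sectionCoord_add`, `sectionCoord_smul`).
* `eq_zero_of_sectionCoord_eq_zero` — **injectivity**: a section whose analytification vanishes is `0` (a
  regular function vanishing at every complex point of the reduced `X` is `0`,
  `CharPolyRegular.eq_zero_of_forall_eval_eq_zero`).
* `exists_isSection_of_mem_sectionSpace` — **surjectivity**: every holomorphic section `σ` of `𝒪_X(D)^an` is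
  `s^an` for an algebraic section `s`.  Serre's road through n° 19 Prop. 15 («holomorphe ⇒ régulière»): on
  the complement `T = X ∖ Supp D` of the support (`CartierDivisor.unitOpens`, where the `f_i` are units) the
  function `g = σ_i · (f_i⁻¹)^an` is frame-independent and holomorphic, and at a point `y ∈ U_i` of the
  support a uniform denominator `b` of `f_i` (`Motives.exists_isDenomAt` on the factorial stalks of the smooth
  `X`, `IsDenomAt.exists_forall_mem_nhds`) exhibits `g · (b² f_i)^an = σ_i · (b^an)²` with HOLOMORPHIC numerator
  and `T = D(b² f_i)` near `y`; so `g` is a REGULAR function `c` on `T`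
  (`exists_section_eval_eq_of_mdifferentiableOn_of_holNumerator`: junk graph, Chow, closed graph).  The
  rational function `s = c` is then a section of `𝒪_X(D)`: on an affine `W ⊆ U_i`, `f_i s = β/α` and
  `σ_i ∘ φ⁻¹ · α^an = β^an` on a dense `D(ατ)(ℂ)`, hence on `W(ℂ)` (`ContinuousRational.eqOn_of_eqOn_basicOpen`),
  so algebraic Hartogs (`isRegularAt_div_of_continuousOn_eval`) makes `f_i s` regular; and `s^an = σ`.
* `exists_linearEquiv_sections_sectionSpace`, **`finrank_sections_eq_finrank_sectionSpace`** —
  `Γ(X, 𝒪_X(D)) ≃ₗ[ℂ] Γ(M, 𝒪_X(D)^an)` compatibly with `s ↦ s^an`, and `h⁰(D) = h⁰(𝒪_X(D)^an)`.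
* **`AbelianVariety.finrank_sections_eq_finrank_sectionSpace`** — the case of a complex abelian variety
  uniformised by a complex torus (`AbelianVariety.isSmoothProjective_holds`).

## References

* [SerreGAGA1956] J.-P. Serre, Géométrie algébrique et géométrie analytique, Ann. Inst. Fourier 6 (1956),
  n° 12 Théorème 1 (p. 19), n° 19 Prop. 15 (pp. 29–30).
* [GortzWedhorn2020] U. Görtz, T. Wedhorn, Algebraic Geometry I, 2nd ed. (2020), Section (11.9) (p. 374),
  Thm. 6.45.
* [Mumford1981] D. Mumford, Algebraic Geometry I: Complex Projective Varieties (1981), §4B (4.14), p. 67.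
-/

noncomputable section

open scoped Manifold ContDiff Topology
open CategoryTheory AlgebraicGeometry Set
open Literature.AlgebraicGeometry.Motives
open Literature.AlgebraicGeometry.Motives.AlgPoints (evalOrZero evalOrZero_of_mem evalOrZero_of_not_mem
  evalOrZero_map_homOfLE)
open Literature.AlgebraicGeometry.Motives.RatFn
open Literature.Geometry.Kaehler
open Literature.NumberTheory.Transcendental
open Literature.AlgebraicGeometry.FundamentalGroup

namespace Literature.AlgebraicGeometry.HodgeTheory

section Main

variable {n : ℕ} {X : SchemeOver ℂ} [IsIntegral X.left]
  {E : Type*} [NormedAddCommGroup E] [NormedSpace ℂ E] [FiniteDimensional ℂ E]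
  {M : Type*} [TopologicalSpace M] [ChartedSpace E M] [IsManifold 𝓘(ℂ, E) ω M]
  {φ : M → ComplexPoints X}

/-! ### The analytification `s ↦ s^an` of algebraic sections -/

omit [IsManifold 𝓘(ℂ, E) ω M] in
open scoped Classical in
/-- **`s^an ∈ Γ(M, 𝒪_X(D)^an)`**: the coordinates `(f_i s) ∘ φ` of `s ∈ Γ(X, 𝒪_X(D))`, set to `0` off
`φ⁻¹(U_i(ℂ))`, form an element of the section space of `cartierDivisorLineBundle hφ D` (holomorphic:
Serre GAGA §2 n°6; rule `s_j = g_{ji} s_i`: Görtz–Wedhorn I (11.9)). [cite: SerreGAGA1956, §2 n°6]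
[cite: GortzWedhorn2020, Section (11.9) (p. 374)] -/
theorem sectionCoord_mem_sectionSpace (hφ : IsAnalytification E X n φ) (D : CartierDivisor X.left)
    {s : X.left.functionField} (hs : D.IsSection s) :
    (fun i m ↦ if (φ m).pt ∈ D.U i then D.sectionCoord φ hs i m else 0) ∈
      (cartierDivisorLineBundle hφ D).sectionSpace :=
  (HolomorphicLineBundle.GlobalSection.normalize
    ({ coord := fun i ↦ D.sectionCoord φ hs i
       mdifferentiableOn_coord := fun i ↦ mdifferentiableOn_sectionCoord hφ hs i
       coord_eq_mul := fun _ _ _ hx ↦ sectionCoord_eq_mul hs hx.1 hx.2 } :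
      (cartierDivisorLineBundle hφ D).GlobalSection)).2

omit [TopologicalSpace M] in
/-- The coordinates of a sum: `(f_i (s + t))(φ m) = (f_i s)(φ m) + (f_i t)(φ m)` (`Γ(X, 𝒪_X(D))` is a
sub-vector-space of `K(X)`, Görtz–Wedhorn I (11.9)). [cite: GortzWedhorn2020, Section (11.9) (p. 374)] -/
theorem sectionCoord_add (D : CartierDivisor X.left) {s t : X.left.functionField} (hs : D.IsSection s)
    (ht : D.IsSection t) (hst : D.IsSection (s + t)) (i : D.ι) {m : M} (hm : (φ m).pt ∈ D.U i) :
    D.sectionCoord φ hst i m = D.sectionCoord φ hs i m + D.sectionCoord φ ht i m := by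
  rw [sectionCoord_apply_of_mem hst hm, sectionCoord_apply_of_mem hs hm, sectionCoord_apply_of_mem ht hm,
    ← Pi.add_apply (evalOrZero (D.U i) _) (evalOrZero (D.U i) _) (φ m), ← GAGADimension.evalOrZero_add]
  congr 1
  refine section_ext fun hU ↦ ?_
  simp only [map_add, ofSection_sectionOf, mul_add]

omit [TopologicalSpace M] in
/-- The coordinates of a scalar multiple: `(f_i (c • s))(φ m) = c · (f_i s)(φ m)` (`Γ(X, 𝒪_X(D))` is a
sub-vector-space of `K(X)`, Görtz–Wedhorn I (11.9)). [cite: GortzWedhorn2020, Section (11.9) (p. 374)] -/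
theorem sectionCoord_smul (D : CartierDivisor X.left) {s : X.left.functionField} (hs : D.IsSection s)
    (c : ℂ) {t : X.left.functionField} (hts : t = c • s) (ht : D.IsSection t) (i : D.ι) {m : M}
    (hm : (φ m).pt ∈ D.U i) :
    D.sectionCoord φ ht i m = c * D.sectionCoord φ hs i m := by
  -- the rational function of the scalar section `c ∈ Γ(U_i, 𝒪_X)` is the constant `c ∈ K(X)`
  have hscal : ∀ hU : genericPoint X.left ∈ D.U i,
      ofSection hU (SchemeOver.scalarRingHom X (D.U i) c) = algebraMap ℂ X.left.functionField c := by
    intro hU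
    have h1 : SchemeOver.scalarRingHom X (D.U i) c = X.left.presheaf.map (homOfLE (le_top : D.U i ≤ ⊤)).op
        (X.hom.appTop ((Scheme.ΓSpecIso (.of ℂ)).inv c)) := rfl
    rw [h1, ofSection_map]
    exact (RatFn.algebraMap_stalk_apply (K := ℂ) (genericPoint X.left) c).symm
  have hsec : sectionOf (genericPoint_mem_of_mem hm) (D.f i * t) (fun y hy ↦ ht i y hy) =
      SchemeOver.scalarRingHom X (D.U i) c *
        sectionOf (genericPoint_mem_of_mem hm) (D.f i * s) (fun y hy ↦ hs i y hy) := by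
    refine section_ext fun hU ↦ ?_
    have e3 : ofSection hU (SchemeOver.scalarRingHom X (D.U i) c *
        sectionOf (genericPoint_mem_of_mem hm) (D.f i * s) (fun y hy ↦ hs i y hy)) =
        ofSection hU (SchemeOver.scalarRingHom X (D.U i) c) *
          ofSection hU (sectionOf (genericPoint_mem_of_mem hm) (D.f i * s) (fun y hy ↦ hs i y hy)) :=
      map_mul (X.left.presheaf.germ (D.U i) (genericPoint X.left) hU).hom _ _
    rw [e3, ofSection_sectionOf, ofSection_sectionOf, hscal, hts, Algebra.smul_def, mul_left_comm]
  rw [sectionCoord_apply_of_mem ht hm, sectionCoord_apply_of_mem hs hm, hsec, evalOrZero_mul_apply,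
    GAGADimension.evalOrZero_scalarRingHom (D.U i) c hm]

/-! ### Injectivity: a section with vanishing analytification is zero -/

omit [IsManifold 𝓘(ℂ, E) ω M] in
/-- **`s^an = 0 ⇒ s = 0`**: if all the coordinates `(f_i s)(φ m)`, `φ m ∈ U_i(ℂ)`, of a section
`s ∈ Γ(X, 𝒪_X(D))` vanish, then `s = 0` — the regular function `f_i s ∈ Γ(U_i, 𝒪_X)` vanishes at every
complex point of the reduced, locally of finite type `U_i` (`φ` is onto `X(ℂ)`), hence is `0`, and `f_i ≠ 0`.
[cite: SerreGAGA1956, n° 12 Théorème 1 (p. 19)] -/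
theorem eq_zero_of_sectionCoord_eq_zero [LocallyOfFiniteType X.hom] (hφ : IsAnalytification E X n φ)
    (D : CartierDivisor X.left) {s : X.left.functionField} (hs : D.IsSection s)
    (h0 : ∀ (i : D.ι) (m : M), (φ m).pt ∈ D.U i → D.sectionCoord φ hs i m = 0) : s = 0 := by
  obtain ⟨x₀⟩ : Nonempty X.left := inferInstance
  obtain ⟨i, hi⟩ := D.covers x₀
  have hgen : genericPoint X.left ∈ D.U i := genericPoint_mem_of_mem hi
  set γ : Γ(X.left, D.U i) := sectionOf hgen (D.f i * s) (fun y hy ↦ hs i y hy) with hγ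
  have hγ0 : γ = 0 := by
    refine CharPolyRegular.eq_zero_of_forall_eval_eq_zero γ fun P hP ↦ ?_
    have hm : (φ (hφ.homeomorph.symm P)).pt ∈ D.U i := by
      rw [show φ (hφ.homeomorph.symm P) = P from hφ.homeomorph.apply_symm_apply P]
      exact hP
    have h := h0 i (hφ.homeomorph.symm P) hm
    rw [sectionCoord_apply_of_mem hs hm] at h
    simp only [show φ (hφ.homeomorph.symm P) = P from hφ.homeomorph.apply_symm_apply P,
      evalOrZero_of_mem _ hP] at h
    exact h
  have hfs : D.f i * s = 0 := by
    rw [← ofSection_sectionOf hgen (D.f i * s) (fun y hy ↦ hs i y hy), ← hγ, hγ0]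
    exact map_zero (X.left.presheaf.germ (D.U i) (genericPoint X.left) hgen).hom
  exact (mul_eq_zero.1 hfs).resolve_left (D.f_ne_zero i)

/-! ### Surjectivity: every holomorphic section of `𝒪_X(D)^an` is algebraic -/

/-- **The local step of the surjectivity (density + algebraic Hartogs on one open `W`).** Let `X/ℂ` be
integral, locally of finite type, with regular local rings, `W ∋ η` an open, `r = β / α` a rational function
presented by `α, β ∈ Γ(X, W)` with `α ≠ 0`, and `G` a function continuous on `W(ℂ)` with `G · α^an = β^an`
on `D(α τ)(ℂ)` for some `τ ≠ 0`.  Then the identity holds on all of `W(ℂ)` (density,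
`ContinuousRational.eqOn_of_eqOn_basicOpen`), `r` is REGULAR on `W` (algebraic Hartogs,
`isRegularAt_div_of_continuousOn_eval`), and the values of `r` on `W(ℂ)` are those of `G`.
[cite: SerreGAGA1956, n° 19 Prop. 15 (pp. 29–30)] [cite: GortzWedhorn2020, Thm. 6.45] -/
theorem isRegularAt_and_evalOrZero_eq_of_continuousOn [LocallyOfFiniteType X.hom]
    (hreg : ∀ x : X.left, IsRegularLocalRing (X.left.presheaf.stalk x))
    {W : X.left.Opens} (hWgen : genericPoint X.left ∈ W) {α β τ : Γ(X.left, W)} (hα : α ≠ 0) (hτ : τ ≠ 0)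
    {r : X.left.functionField}
    (hr : r = ofSection hWgen β / ofSection hWgen α)
    {G : ComplexPoints X → ℂ} (hG : ContinuousOn G {P | P.pt ∈ W})
    (hGαβ : ∀ P : ComplexPoints X, P.pt ∈ W → P.pt ∈ X.left.basicOpen (α * τ) →
      G P * evalOrZero W α P = evalOrZero W β P) :
    (∀ x ∈ W, IsRegularAt x r) ∧
      ∀ (hrW : ∀ x ∈ W, IsRegularAt x r) (P : ComplexPoints X), P.pt ∈ W →
        evalOrZero W (sectionOf hWgen r hrW) P = G P := by
  haveI : Nonempty W := ⟨⟨genericPoint X.left, hWgen⟩⟩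
  -- `G α = β` on all of `W(ℂ)` by density
  have hGαβ' : ∀ P : ComplexPoints X, P.pt ∈ W → G P * evalOrZero W α P = evalOrZero W β P :=
    ContinuousRational.eqOn_of_eqOn_basicOpen (s := α * τ) (mul_ne_zero hα hτ)
      (hG.mul (AlgPoints.continuousOn_evalOrZero W α)) (AlgPoints.continuousOn_evalOrZero W β) hGαβ
  have hαK : ofSection hWgen α ≠ 0 := (RatFn.algebraMap_ne_zero_iff (X := X.left) (V := W)).2 hα
  have hαreg : ∀ y ∈ W, IsRegularAt y (ofSection hWgen α) := fun y hy ↦ isRegularAt_ofSection hy α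
  have hβreg : ∀ y ∈ W, IsRegularAt y (ofSection hWgen β) := fun y hy ↦ isRegularAt_ofSection hy β
  have hsα : sectionOf hWgen (ofSection hWgen α) hαreg = α := section_ext fun hU ↦ by rw [ofSection_sectionOf]
  have hsβ : sectionOf hWgen (ofSection hWgen β) hβreg = β := section_ext fun hU ↦ by rw [ofSection_sectionOf]
  have hregW : ∀ x ∈ W, IsRegularAt x r := by
    intro x hx
    rw [hr]
    refine isRegularAt_div_of_continuousOn_eval hreg hWgen hαK hαreg hβreg hG (fun P hP ↦ ?_) hx
    rw [hsα, hsβ, ← evalOrZero_of_mem α hP, ← evalOrZero_of_mem β hP]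
    exact hGαβ' P hP
  refine ⟨hregW, fun hrW P hP ↦ ?_⟩
  -- `γ α = β` as sections, so `γ^an α^an = β^an = G α^an`; cancel `α^an` on `D(α τ)` and conclude by density
  set γ := sectionOf hWgen r hrW with hγ
  have hγα : ∀ Q : ComplexPoints X, Q.pt ∈ W → evalOrZero W γ Q * evalOrZero W α Q = evalOrZero W β Q := by
    intro Q hQ
    rw [← evalOrZero_mul_apply]
    congr 1
    refine section_ext fun hU ↦ ?_
    have e3 : ofSection hU (γ * α) = ofSection hU γ * ofSection hU α :=
      map_mul (X.left.presheaf.germ W (genericPoint X.left) hU).hom _ _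
    rw [e3, hγ, ofSection_sectionOf, hr, div_mul_cancel₀ _ hαK]
  refine ContinuousRational.eqOn_of_eqOn_basicOpen (s := α * τ) (mul_ne_zero hα hτ)
    (AlgPoints.continuousOn_evalOrZero W γ) hG (fun Q hQ hQατ ↦ ?_) P hP
  rw [Scheme.basicOpen_mul] at hQατ
  have hαQ : evalOrZero W α Q ≠ 0 := by
    rw [evalOrZero_of_mem _ hQ]
    exact (AlgPoints.pt_mem_basicOpen_iff Q hQ α).1 hQατ.1
  exact mul_right_cancel₀ hαQ ((hγα Q hQ).trans (hGαβ' Q hQ).symm)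

/-- **Every holomorphic section of `𝒪_X(D)^an` is algebraic** (`X` smooth projective over `ℂ`, `φ` any
analytification): for `σ ∈ Γ(M, 𝒪_X(D)^an)` there is `s ∈ Γ(X, 𝒪_X(D))` with `s^an = σ`, i.e.
`σ_i(m) = (f_i s)(φ m)` on `φ⁻¹(U_i(ℂ))`.  Serre n° 19 Prop. 15 applied to `g = σ_i · (f_i⁻¹)^an` on
`T = X ∖ Supp D` (holomorphic, with holomorphic numerators `σ_i (b^an)²` over the uniform denominators
`b² f_i` at the points of the support), then algebraic Hartogs for `f_i s` on affine patches.
[cite: SerreGAGA1956, n° 12 Théorème 1 (p. 19) and n° 19 Prop. 15 (pp. 29–30)] [cite: Mumford1981, §4B (4.14), p. 67] -/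
theorem exists_isSection_of_mem_sectionSpace (hX : IsSmoothProjective n X) (hφ : IsAnalytification E X n φ)
    (D : CartierDivisor X.left) (σ : (cartierDivisorLineBundle hφ D).sectionSpace) :
    ∃ (s : X.left.functionField) (hs : D.IsSection s),
      ∀ (i : D.ι) (m : M), (φ m).pt ∈ D.U i → (σ : D.ι → M → ℂ) i m = D.sectionCoord φ hs i m := by
  classical
  haveI : SmoothOfRelativeDimension n X.hom := hX.smoothOfRelativeDimension
  haveI : Smooth X.hom := SmoothOfRelativeDimension.smooth n X.hom
  haveI : LocallyOfFiniteType X.hom := inferInstance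
  haveI : IsLocallyNoetherian X.left := LocallyOfFiniteType.isLocallyNoetherian X.hom
  have hregX : ∀ x : X.left, IsRegularLocalRing (X.left.presheaf.stalk x) := fun x ↦
    Literature.AlgebraicGeometry.Motives.isRegularLocalRing_stalk_of_smoothOfRelativeDimension X.hom n x
  have hUFD : ∀ x : X.left, UniqueFactorizationMonoid (X.left.presheaf.stalk x) := fun x ↦
    Literature.AlgebraicGeometry.Resolution.Matsumura1987_20_3_holds _ (hregX x)
  /- the section `σ`: holomorphic coordinates with `σ_j = (f_j/f_i) σ_i` -/
  have hσhol : ∀ i, MDifferentiableOn 𝓘(ℂ, E) 𝓘(ℂ, ℂ) ((σ : D.ι → M → ℂ) i) (φ ⁻¹' {P | P.pt ∈ D.U i}) :=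
    fun i ↦ HolomorphicLineBundle.mdifferentiableOn_of_mem_sectionSpace σ i
  have hσmul : ∀ {i j} {m : M}, (φ m).pt ∈ D.U i → (φ m).pt ∈ D.U j →
      (σ : D.ι → M → ℂ) j m = evalOrZero (D.U j ⊓ D.U i) (D.transFun j i) (φ m) * (σ : D.ι → M → ℂ) i m :=
    fun hi hj ↦ HolomorphicLineBundle.apply_eq_mul_of_mem_sectionSpace σ _ _ ⟨hi, hj⟩
  /- the off-support open `T = X₁` and the inverse frames `ρ_i = (f_i⁻¹)^an` on `V_i = U_i ∩ T` -/
  set T : X.left.Opens := D.nonvanishingOpens 1 with hT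
  have hT_iff : ∀ {i} {x : X.left}, x ∈ D.U i → (x ∈ T ↔ IsUnitAt x (D.f i)) := by
    intro i x hi
    change x ∈ D.nonvanishing 1 ↔ _
    rw [CartierDivisor.mem_nonvanishing_iff (D := D) hi, mul_one]
  have hV_iff : ∀ {i} {x : X.left}, x ∈ D.unitOpens i ↔ x ∈ D.U i ∧ x ∈ T := fun {i x} ↦ Iff.rfl
  have hρreg : ∀ i, ∀ y ∈ D.unitOpens i, IsRegularAt y (D.f i)⁻¹ := fun i y hy ↦
    (CartierDivisor.isUnitAt_f_of_mem_unitOpens hy).inv.isRegularAt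
  set ρ : D.ι → ComplexPoints X → ℂ := fun i P ↦
    if hg : genericPoint X.left ∈ D.unitOpens i then evalOrZero (D.unitOpens i) (sectionOf hg (D.f i)⁻¹ (hρreg i)) P
    else 0 with hρ
  have hρ_of_mem : ∀ {i} {P : ComplexPoints X} (hP : P.pt ∈ D.unitOpens i),
      ρ i P = evalOrZero (D.unitOpens i) (sectionOf (genericPoint_mem_of_mem hP) (D.f i)⁻¹ (hρreg i)) P := by
    intro i P hP
    rw [hρ]
    exact dif_pos (genericPoint_mem_of_mem hP)
  have hρ_ne : ∀ {i} {P : ComplexPoints X} (hP : P.pt ∈ D.unitOpens i), ρ i P ≠ 0 := by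
    intro i P hP
    rw [hρ_of_mem hP]
    exact evalOrZero_sectionOf_ne_zero _ (hρreg i) hP (CartierDivisor.isUnitAt_f_of_mem_unitOpens hP).inv
  have hρ_hol : ∀ i, MDifferentiableOn 𝓘(ℂ, E) 𝓘(ℂ, ℂ) (fun m ↦ ρ i (φ m)) (φ ⁻¹' {P | P.pt ∈ D.unitOpens i}) := by
    intro i
    by_cases hg : genericPoint X.left ∈ D.unitOpens i
    · have heq : (fun m ↦ ρ i (φ m)) =
          fun m ↦ evalOrZero (D.unitOpens i) (sectionOf hg (D.f i)⁻¹ (hρreg i)) (φ m) := by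
        funext m
        rw [hρ]
        exact dif_pos hg
      rw [heq]
      exact IsAnalytification.mdifferentiableOn_evalOrZero_opens_holds hφ (D.unitOpens i) _
    · intro m hm
      exact absurd (genericPoint_mem_of_mem hm) hg
  -- frame independence: `σ_j ρ_j = σ_i ρ_i` on `V_i ∩ V_j`
  have hcompat : ∀ {i j} {m : M}, (φ m).pt ∈ D.unitOpens i → (φ m).pt ∈ D.unitOpens j →
      (σ : D.ι → M → ℂ) i m * ρ i (φ m) = (σ : D.ι → M → ℂ) j m * ρ j (φ m) := by
    intro i j m hi hj
    -- `ρ_i = ρ_j (f_j / f_i)` at `φ m`: `f_i⁻¹ = f_j⁻¹ (f_j/f_i)` in `K(X)`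
    have hval : ρ i (φ m) = ρ j (φ m) * evalOrZero (D.U j ⊓ D.U i) (D.transFun j i) (φ m) := by
      rw [hρ_of_mem hi, hρ_of_mem hj]
      refine evalOrZero_eq_mul_of_ofSection _ _ _ hi hj ⟨hj.1, hi.1⟩ ?_
      rw [ofSection_sectionOf, ofSection_sectionOf, CartierDivisor.ofSection_transFun]
      have h1 := D.f_ne_zero i; have h2 := D.f_ne_zero j
      field_simp
    rw [hσmul hi.1 hj.1, hval]
    ring
  /- the glued function `g = σ_i ρ_i` on `φ⁻¹(T(ℂ))` -/
  set i₀ : M → D.ι := fun m ↦ (D.covers (φ m).pt).choose with hi₀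
  have hi₀m : ∀ m, (φ m).pt ∈ D.U (i₀ m) := fun m ↦ (D.covers (φ m).pt).choose_spec
  set g : M → ℂ := fun m ↦ (σ : D.ι → M → ℂ) (i₀ m) m * ρ (i₀ m) (φ m) with hg
  have hg_eq : ∀ {i} {m : M}, (φ m).pt ∈ D.unitOpens i → g m = (σ : D.ι → M → ℂ) i m * ρ i (φ m) := by
    intro i m hm
    rw [hg]
    exact hcompat ⟨hi₀m m, hm.2⟩ hm
  have hg_hol : MDifferentiableOn 𝓘(ℂ, E) 𝓘(ℂ, ℂ) g (φ ⁻¹' {Q | Q.pt ∈ T}) := by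
    refine mdifferentiableOn_of_locally_mdifferentiableOn fun m hm ↦ ?_
    obtain ⟨i, hi⟩ := D.covers (φ m).pt
    refine ⟨φ ⁻¹' {Q | Q.pt ∈ D.unitOpens i}, hφ.isOpen_preimage (D.unitOpens i), ⟨hi, hm⟩, ?_⟩
    have hsub : φ ⁻¹' {Q | Q.pt ∈ T} ∩ φ ⁻¹' {Q | Q.pt ∈ D.unitOpens i} ⊆ φ ⁻¹' {Q | Q.pt ∈ D.unitOpens i} :=
      Set.inter_subset_right
    refine (((hσhol i).mono fun m' hm' ↦ (hsub hm').1).mul ((hρ_hol i).mono hsub)).congr fun m' hm' ↦ ?_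
    exact hg_eq (hsub hm')
  /- local holomorphic-numerator form at the points of the support -/
  have H : ∀ m : M, (φ m).pt ∉ T → ∃ (W : X.left.Opens) (b : Γ(X.left, W)) (P : M → ℂ), (φ m).pt ∈ W ∧
      MDifferentiableOn 𝓘(ℂ, E) 𝓘(ℂ, ℂ) P (φ ⁻¹' {Q | Q.pt ∈ W}) ∧
      ∀ m', (φ m').pt ∈ W →
        ((φ m').pt ∈ T ↔ evalOrZero W b (φ m') ≠ 0) ∧
        ((φ m').pt ∈ T → g m' * evalOrZero W b (φ m') = P m') := by
    intro m₀ _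
    set y := (φ m₀).pt with hy
    obtain ⟨i, hi⟩ := D.covers y
    obtain ⟨b₀, hb₀⟩ := exists_isDenomAt (hUFD y) (D.f i)
    obtain ⟨W₀, b, hyW₀, hb0, hden⟩ := hb₀.exists_forall_mem_nhds
    set W : X.left.Opens := W₀ ⊓ D.U i with hW
    have hyW : y ∈ W := ⟨hyW₀, hi⟩
    have hgen : genericPoint X.left ∈ W := genericPoint_mem_of_mem hyW
    have hbreg : ∀ y' ∈ W, IsRegularAt y' b := fun y' hy' ↦ (hden y' hy'.1).isRegularAt
    have hareg : ∀ y' ∈ W, IsRegularAt y' (b * D.f i) := fun y' hy' ↦ (hden y' hy'.1).isRegularAt_mul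
    set β : Γ(X.left, W) := sectionOf hgen b hbreg with hβ
    set α : Γ(X.left, W) := sectionOf hgen (b * D.f i) hareg with hα
    -- `T ∩ W = D(α) ∩ D(β)`
    have hunit_iff : ∀ y' ∈ W, (IsUnitAt y' (D.f i) ↔ IsUnitAt y' (b * D.f i) ∧ IsUnitAt y' b) := by
      intro y' hy'
      constructor
      · intro hr'
        have hb' : IsUnitAt y' b := ((hden y' hy'.1).isRegularAt_iff).1 hr'.isRegularAt
        exact ⟨hb'.mul hr', hb'⟩
      · rintro ⟨hbr, hb'⟩
        have := hbr.div hb'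
        rwa [mul_div_cancel_left₀ _ hb0] at this
    have hT_W : ∀ m', (φ m').pt ∈ W → ((φ m').pt ∈ T ↔ evalOrZero W (α * β) (φ m') ≠ 0) := by
      intro m' hm'
      rw [hT_iff hm'.2, hunit_iff _ hm', evalOrZero_mul_apply, mul_ne_zero_iff,
        ← isUnitAt_ofSection_iff_evalOrZero_ne_zero α hm', ← isUnitAt_ofSection_iff_evalOrZero_ne_zero β hm',
        hα, hβ, ofSection_sectionOf, ofSection_sectionOf]
    refine ⟨W, α * β, fun m' ↦ (σ : D.ι → M → ℂ) i m' * (evalOrZero W β (φ m') * evalOrZero W β (φ m')), hyW,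
      ?_, fun m' hm' ↦ ⟨hT_W m' hm', fun hT' ↦ ?_⟩⟩
    · have hβhol := IsAnalytification.mdifferentiableOn_evalOrZero_opens_holds hφ W β
      exact ((hσhol i).mono fun m' (hm' : (φ m').pt ∈ W) ↦ hm'.2).mul (hβhol.mul hβhol)
    · have hV : (φ m').pt ∈ D.unitOpens i := ⟨hm'.2, hT'⟩
      -- `ρ_i(P) α(P) = β(P)`: `b = f_i⁻¹ (b f_i)` in `K(X)`
      have hρα : evalOrZero W β (φ m') = ρ i (φ m') * evalOrZero W α (φ m') := by
        rw [hρ_of_mem hV]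
        refine evalOrZero_eq_mul_of_ofSection β _ α hm' hV hm' ?_
        rw [hα, hβ, ofSection_sectionOf, ofSection_sectionOf, ofSection_sectionOf]
        rw [mul_left_comm, inv_mul_cancel₀ (D.f_ne_zero i), mul_one]
      rw [hg_eq hV, evalOrZero_mul_apply]
      simp only [hρα]
      ring
  /- Serre n° 19 Prop. 15: `g` is a regular function `c` on `T` -/
  obtain ⟨c, hc⟩ := exists_section_eval_eq_of_mdifferentiableOn_of_holNumerator hX hφ T g hg_hol H
  obtain ⟨x₁, hx₁⟩ := D.nonvanishing_nonempty (one_ne_zero (α := X.left.functionField))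
  have hTgen : genericPoint X.left ∈ T := genericPoint_mem_of_mem (U := T) hx₁
  set s : X.left.functionField := ofSection hTgen c with hs_def
  -- the continuous functions `G_i = σ_i ∘ φ⁻¹` on `U_i(ℂ)`
  set G : D.ι → ComplexPoints X → ℂ := fun i P ↦ (σ : D.ι → M → ℂ) i (hφ.homeomorph.symm P) with hG
  have hφsymm : ∀ P : ComplexPoints X, φ (hφ.homeomorph.symm P) = P := fun P ↦ hφ.homeomorph.apply_symm_apply P
  have hGcont : ∀ i, ContinuousOn (G i) {P | P.pt ∈ D.U i} := by
    intro i
    refine ((hσhol i).continuousOn.comp hφ.homeomorph.symm.continuous.continuousOn fun P hP ↦ ?_)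
    change (φ (hφ.homeomorph.symm P)).pt ∈ D.U i
    rw [hφsymm]
    exact hP
  -- values of `c` on `V_i(ℂ)`: `c(P) = G_i(P) ρ_i(P)`
  have hc_val : ∀ {i} {P : ComplexPoints X} (hP : P.pt ∈ D.unitOpens i),
      evalOrZero T c P = G i P * ρ i P := by
    intro i P hP
    have hP' : (φ (hφ.homeomorph.symm P)).pt ∈ D.unitOpens i := by rw [hφsymm]; exact hP
    have h1 := hc (hφ.homeomorph.symm P) (by rw [hφsymm]; exact hP.2)
    rw [hφsymm] at h1
    rw [h1, hg_eq hP', hφsymm]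
  /- the local presentation on affine patches: `f_i s = β/α`, `G_i α^an = β^an` on `D(α τ)(ℂ)` -/
  have hloc : ∀ (i : D.ι) (x : X.left), x ∈ D.U i → ∃ (W : X.left.Opens) (hWgen : genericPoint X.left ∈ W)
      (α β τ : Γ(X.left, W)), x ∈ W ∧ W ≤ D.U i ∧ α ≠ 0 ∧ τ ≠ 0 ∧
      D.f i * s = ofSection hWgen β / ofSection hWgen α ∧
      ∀ P : ComplexPoints X, P.pt ∈ W → P.pt ∈ X.left.basicOpen (α * τ) →
        G i P * evalOrZero W α P = evalOrZero W β P := by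
    intro i x hi
    obtain ⟨W, hW, hxW, hWle⟩ := exists_isAffineOpen_mem_and_subset (X := X.left) (U := D.U i) (x := x) hi
    have hWle' : W ≤ D.U i := hWle
    haveI : Nonempty W := ⟨⟨x, hxW⟩⟩
    have hWgen : genericPoint X.left ∈ W := genericPoint_mem_of_mem hxW
    haveI := functionField_isFractionRing_of_isAffineOpen X.left W hW
    obtain ⟨⟨β, α'⟩, hαβ⟩ := IsLocalization.surj (nonZeroDivisors Γ(X.left, W)) (D.f i * s)
    set α : Γ(X.left, W) := (α' : Γ(X.left, W)) with hαdef
    have hα0 : α ≠ 0 := nonZeroDivisors.coe_ne_zero α'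
    have hαK : ofSection hWgen α ≠ 0 := (RatFn.algebraMap_ne_zero_iff (X := X.left) (V := W)).2 hα0
    have hq : D.f i * s = ofSection hWgen β / ofSection hWgen α := by
      rw [eq_div_iff hαK]
      exact hαβ
    -- a basic open `D(τ) ⊆ T ∩ W`
    obtain ⟨τ, hτle, hτgen⟩ := hW.exists_basicOpen_le
      (⟨genericPoint X.left, (⟨hTgen, hWgen⟩ : genericPoint X.left ∈ T ⊓ W)⟩ : ↥(T ⊓ W)) hWgen
    have hτ0 : τ ≠ 0 := by
      intro h0
      rw [h0, Scheme.basicOpen_zero] at hτgen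
      exact hτgen
    refine ⟨W, hWgen, α, β, τ, hxW, hWle', hα0, hτ0, hq, fun P hPW hPατ ↦ ?_⟩
    rw [Scheme.basicOpen_mul] at hPατ
    have hPT : P.pt ∈ T := (hτle hPατ.2).1
    have hPV : P.pt ∈ D.unitOpens i := ⟨hWle' hPW, hPT⟩
    -- `β f_i⁻¹ = c α` in `K(X)` (from `f_i s = β / α`, `s = c`), evaluated at `P`
    have hval : evalOrZero W β P * ρ i P = evalOrZero T c P * evalOrZero W α P := by
      rw [hρ_of_mem hPV]
      refine evalOrZero_mul_eq_mul_of_ofSection β _ c α (P := P) hPW hPV hPT hPW ?_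
      rw [ofSection_sectionOf]
      change ofSection hWgen β * (D.f i)⁻¹ = s * ofSection hWgen α
      have hfi := D.f_ne_zero i
      rw [eq_div_iff hαK] at hq
      -- hq : (f_i s) α = β
      rw [← hq, mul_inv_eq_iff_eq_mul₀ hfi]
      ring
    rw [hc_val hPV] at hval
    -- hval : β ρ = (G ρ) α ⇒ β = G α
    have hρP : ρ i P ≠ 0 := hρ_ne hPV
    apply mul_right_cancel₀ hρP
    linear_combination hval.symm
  /- `s` is a section of `𝒪_X(D)` -/
  have hs : D.IsSection s := by
    intro i x hi
    obtain ⟨W, hWgen, α, β, τ, hxW, hWle, hα0, hτ0, hq, hGαβ⟩ := hloc i x hi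
    exact (isRegularAt_and_evalOrZero_eq_of_continuousOn hregX hWgen hα0 hτ0 hq
      ((hGcont i).mono fun P hP ↦ hWle hP) hGαβ).1 x hxW
  refine ⟨s, hs, fun i m hm ↦ ?_⟩
  /- `s^an = σ` -/
  obtain ⟨W, hWgen, α, β, τ, hxW, hWle, hα0, hτ0, hq, hGαβ⟩ := hloc i (φ m).pt hm
  obtain ⟨hrW, hval⟩ := isRegularAt_and_evalOrZero_eq_of_continuousOn hregX hWgen hα0 hτ0 hq
    ((hGcont i).mono fun P hP ↦ hWle hP) hGαβ
  have h1 := hval hrW (φ m) hxW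
  -- the section of `f_i s` over `U_i` restricts to the one over `W`
  have hres : X.left.presheaf.map (homOfLE hWle).op
      (sectionOf (genericPoint_mem_of_mem hm) (D.f i * s) fun y hy ↦ hs i y hy) = sectionOf hWgen (D.f i * s) hrW :=
    section_ext fun hU ↦ by rw [ofSection_map, ofSection_sectionOf, ofSection_sectionOf]
  rw [sectionCoord_apply_of_mem hs hm, ← evalOrZero_map_homOfLE hWle _ hxW, hres, h1, hG]
  simp only
  rw [show hφ.homeomorph.symm (φ m) = m from hφ.homeomorph.symm_apply_apply m]

/-! ### The comparison isomorphism and `h⁰` -/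

/-- **GAGA for `H⁰(𝒪_X(D))` (Serre 1956, n° 12 Théorème 1 for `ℱ = 𝒪_X(D)`)**: for `X` smooth projective over
`ℂ` with analytification `φ : M → X(ℂ)` and a Cartier divisor `D` on `X`, the analytification `s ↦ s^an`
is a `ℂ`-linear ISOMORPHISM `Γ(X, 𝒪_X(D)) ≅ Γ(M, 𝒪_X(D)^an)` (`(e s)_i = (f_i s) ∘ φ` on `φ⁻¹(U_i(ℂ))`).
[cite: SerreGAGA1956, n° 12 Théorème 1 (p. 19)] -/
theorem exists_linearEquiv_sections_sectionSpace (hX : IsSmoothProjective n X) (hφ : IsAnalytification E X n φ)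
    (D : CartierDivisor X.left) :
    ∃ e : D.sections ℂ ≃ₗ[ℂ] (cartierDivisorLineBundle hφ D).sectionSpace,
      ∀ (s : D.sections ℂ) (i : D.ι) (m : M), (φ m).pt ∈ D.U i →
        ((e s : (cartierDivisorLineBundle hφ D).sectionSpace) : D.ι → M → ℂ) i m = D.sectionCoord φ s.2 i m := by
  classical
  haveI : SmoothOfRelativeDimension n X.hom := hX.smoothOfRelativeDimension
  haveI : Smooth X.hom := SmoothOfRelativeDimension.smooth n X.hom
  haveI : LocallyOfFiniteType X.hom := inferInstance
  set L := cartierDivisorLineBundle hφ D with hL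
  -- the analytification as an element of the section space
  let an : D.sections ℂ → L.sectionSpace := fun s ↦
    (HolomorphicLineBundle.GlobalSection.normalize
      ({ coord := fun i ↦ D.sectionCoord φ s.2 i
         mdifferentiableOn_coord := fun i ↦ mdifferentiableOn_sectionCoord hφ s.2 i
         coord_eq_mul := fun _ _ _ hx ↦ sectionCoord_eq_mul s.2 hx.1 hx.2 } : L.GlobalSection))
  have han : ∀ (s : D.sections ℂ) (i : D.ι) (m : M), (φ m).pt ∈ D.U i →
      ((an s : L.sectionSpace) : D.ι → M → ℂ) i m = D.sectionCoord φ s.2 i m := fun s i m hm ↦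
    HolomorphicLineBundle.GlobalSection.normalize_apply_of_mem _ (i := i) (x := m) hm
  have han0 : ∀ (s : D.sections ℂ) (i : D.ι) (m : M), (φ m).pt ∉ D.U i →
      ((an s : L.sectionSpace) : D.ι → M → ℂ) i m = 0 := fun s i m hm ↦
    HolomorphicLineBundle.apply_eq_zero_of_notMem _ i (x := m) hm
  -- linearity
  have hadd : ∀ s t : D.sections ℂ, an (s + t) = an s + an t := by
    intro s t
    refine Subtype.ext (funext fun i ↦ funext fun m ↦ ?_)
    change ((an (s + t) : L.sectionSpace) : D.ι → M → ℂ) i m =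
      ((an s : L.sectionSpace) : D.ι → M → ℂ) i m + ((an t : L.sectionSpace) : D.ι → M → ℂ) i m
    by_cases hm : (φ m).pt ∈ D.U i
    · rw [han _ i m hm, han _ i m hm, han _ i m hm]
      exact sectionCoord_add D s.2 t.2 (s + t).2 i hm
    · rw [han0 _ i m hm, han0 _ i m hm, han0 _ i m hm, add_zero]
  have hsmul : ∀ (c : ℂ) (s : D.sections ℂ), an (c • s) = c • an s := by
    intro c s
    refine Subtype.ext (funext fun i ↦ funext fun m ↦ ?_)
    change ((an (c • s) : L.sectionSpace) : D.ι → M → ℂ) i m = c * ((an s : L.sectionSpace) : D.ι → M → ℂ) i m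
    by_cases hm : (φ m).pt ∈ D.U i
    · rw [han _ i m hm, han _ i m hm]
      exact sectionCoord_smul D s.2 c rfl (c • s).2 i hm
    · rw [han0 _ i m hm, han0 _ i m hm, mul_zero]
  let anₗ : D.sections ℂ →ₗ[ℂ] L.sectionSpace :=
    { toFun := an, map_add' := hadd, map_smul' := hsmul }
  -- bijectivity
  have hinj : Function.Injective anₗ := by
    rw [injective_iff_map_eq_zero]
    intro s hs0
    have h0 : ∀ (i : D.ι) (m : M), (φ m).pt ∈ D.U i → D.sectionCoord φ s.2 i m = 0 := by
      intro i m hm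
      rw [← han s i m hm]
      change ((anₗ s : L.sectionSpace) : D.ι → M → ℂ) i m = 0
      rw [hs0]
      rfl
    exact Subtype.ext (eq_zero_of_sectionCoord_eq_zero hφ D s.2 h0)
  have hsurj : Function.Surjective anₗ := by
    intro σ
    obtain ⟨s, hs, hσ⟩ := exists_isSection_of_mem_sectionSpace hX hφ D σ
    refine ⟨⟨s, hs⟩, Subtype.ext (funext fun i ↦ funext fun m ↦ ?_)⟩
    change ((an ⟨s, hs⟩ : L.sectionSpace) : D.ι → M → ℂ) i m = (σ : D.ι → M → ℂ) i m
    by_cases hm : (φ m).pt ∈ D.U i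
    · rw [han _ i m hm, hσ i m hm]
    · rw [han0 _ i m hm, HolomorphicLineBundle.apply_eq_zero_of_notMem σ i (x := m) hm]
  exact ⟨LinearEquiv.ofBijective anₗ ⟨hinj, hsurj⟩, fun s i m hm ↦ han s i m hm⟩

/-- **`h⁰(D) = h⁰(𝒪_X(D)^an)`**: `dim_ℂ Γ(X, 𝒪_X(D)) = dim_ℂ Γ(M, 𝒪_X(D)^an)` for `X` smooth projective over `ℂ`,
`φ : M → X(ℂ)` an analytification and `D` a Cartier divisor. [cite: SerreGAGA1956, n° 12 Théorème 1 (p. 19)] -/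
theorem finrank_sections_eq_finrank_sectionSpace (hX : IsSmoothProjective n X) (hφ : IsAnalytification E X n φ)
    (D : CartierDivisor X.left) :
    Module.finrank ℂ (D.sections ℂ) = Module.finrank ℂ (cartierDivisorLineBundle hφ D).sectionSpace := by
  obtain ⟨e, -⟩ := exists_linearEquiv_sections_sectionSpace hX hφ D
  exact e.finrank_eq

end Main

/-! ### Complex abelian varieties -/

/-- **GAGA-`H⁰` on a complex abelian variety**: for `A` an abelian variety over `ℂ` uniformised by a complex
torus, `φ : V/Λ → A(ℂ)` an analytification, and `Θ` a Cartier divisor on `A`,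
`dim_ℂ Γ(A, 𝒪_A(Θ)) = dim_ℂ Γ(V/Λ, 𝒪_A(Θ)^an)` (`A` is smooth projective: `AbelianVariety.isSmoothProjective_holds`).
[cite: SerreGAGA1956, n° 12 Théorème 1 (p. 19)] [cite: MumfordAV1970, §4 (ii) and §6 Application 1 (p. 62)] -/
theorem _root_.Literature.AlgebraicGeometry.Motives.AbelianVariety.finrank_sections_eq_finrank_sectionSpace
    (A : AbelianVariety ℂ) {ι : Type} [Fintype ι] (Φ : (ι → ℝ) ≃L[ℝ] (Fin A.dim → ℂ))
    {φ : ComplexTorus Φ → ComplexPoints A.X} (hφ : IsAnalytification (Fin A.dim → ℂ) A.X A.dim φ)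
    (Θ : CartierDivisor A.X.left) :
    Module.finrank ℂ (Θ.sections ℂ) = Module.finrank ℂ (cartierDivisorLineBundle hφ Θ).sectionSpace :=
  Literature.AlgebraicGeometry.HodgeTheory.finrank_sections_eq_finrank_sectionSpace
    (AbelianVariety.isSmoothProjective_holds (A := A)) hφ Θ

end Literature.AlgebraicGeometry.HodgeTheory

end
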